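import Summits.Ventures.Crystal3D.Theorems.StickyWulffConstantNoReconstructionGainGrainFamilies
import Literature.Algebra.EuclideanLattices.FccBccLattices
import HarnessLib

/-!
# Schedules and slopes of the transport families of a Barlow stacking

HONEST FRAMING. Part of the venture `Summits/Ventures/Crystal3D` (cell `crystal3d-full`), helper
`--supports` the crux `NoReconstructionGain` (stmt-Ventures-19144, route
`route-Ventures-StickyWulffConstant`), line `adhesion`, GRAIN RUNG.  Lattice bookkeeping only:

* `exists_schedule` — from a preferred adjacent-layer offset per Hägg letter (`c s ∈
  threeOffsets (−s)`) build a full schedule `off : Fin 3 → ℤ → ℤ × ℤ` (layer-wise enumeration of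
  the three offsets, `off 0 k = c (σ k)`), as consumed by `sum_card_adj_add` (`…GrainFamilies`);
* the STEP VECTORS of the six families in coordinates: `inner_step_basal₁/₂/₃`,
  `inner_step_chain` — the height gained along `ν` by one step is `ν₀`, `ν₀/2 + (√3/2)ν₁`,
  `ν₀/2 − (√3/2)ν₁` for the in-layer translations and
  `−P ν₀ − Q (ν₀/2 + (√3/2)ν₁) + σ_k (ν₀/2 + (√3/6)ν₁) + h ν₂` for the chain step with offset
  `(P, Q)` from layer `k` (`h = √(2/3)`), matching `orientation_cases` (`…GrainOrientation`);
* `dist_step_basal₁/₂/₃`, `dist_step_chain` — every step has length `1`.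

WHAT THIS IS NOT: anything about packings; rung F-C1 not moved.
-/

noncomputable section

namespace Summit.Ventures.Crystal3D.Theorems

open Finset Real
open Literature.MathematicalPhysics.StatisticalMechanics (barlowPos IsHaggSeq sixOffsets
  threeOffsets haggLabel haggLabel_succ barlowPos_apply_zero barlowPos_apply_one barlowPos_apply_two)
open Literature.Algebra.EuclideanLattices (inner_fin_three)
open scoped InnerProductSpace

/-! ## Schedules -/

/-- **A full schedule from a preferred offset per letter.**  Given `c s ∈ threeOffsets (−s)` for
`s = ±1`, there is a layer-wise enumeration `off` of the adjacent-layer offsets of the stacking of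
`σ` whose first family uses the preferred offsets: `off 0 k = c (σ k)`. -/
theorem exists_schedule {σ : ℤ → ℤ} (hσ : IsHaggSeq σ) (c : ℤ → ℤ × ℤ)
    (hc : ∀ s : ℤ, s = 1 ∨ s = -1 → c s ∈ threeOffsets (-s)) :
    ∃ off : Fin 3 → ℤ → ℤ × ℤ, (∀ k, off 0 k = c (σ k)) ∧
      (∀ m k, off m k ∈ threeOffsets (-σ k)) ∧ (∀ k, Function.Injective fun m => off m k) := by
  -- cyclic successor inside `{(0,0), (s,0), (0,s)}`
  let rot : ℤ → ℤ × ℤ → ℤ × ℤ := fun s PQ =>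
    if PQ = (0, 0) then (s, 0) else if PQ = (s, 0) then (0, s) else (0, 0)
  refine ⟨fun m k => ![c (σ k), rot (σ k) (c (σ k)), rot (σ k) (rot (σ k) (c (σ k)))] m,
    fun k => rfl, ?_, ?_⟩
  · intro m k
    dsimp only
    have hs := hσ k
    have hck := hc (σ k) hs
    generalize hsk : σ k = s at hs hck ⊢
    rcases hs with rfl | rfl <;>
      rcases mem_threeOffsets_neg_iff (by norm_num) _ |>.1 hck with e | e | e <;>
      fin_cases m <;>
      simp [rot, e, threeOffsets]
  · intro k m m' hmm
    dsimp only at hmm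
    have hs := hσ k
    have hck := hc (σ k) hs
    generalize hsk : σ k = s at hs hck hmm
    rcases hs with rfl | rfl <;>
      rcases mem_threeOffsets_neg_iff (by norm_num) _ |>.1 hck with e | e | e <;>
      fin_cases m <;> fin_cases m' <;>
      simp_all [rot]

/-! ## Step vectors of the six families -/

section Steps

variable (σ : ℤ → ℤ) (ν : EuclideanSpace ℝ (Fin 3))

/-- Step of the first in-layer family: `⟪pos (k, i+1, j) − pos (k, i, j), ν⟫ = ν₀`. -/
theorem inner_step_basal₁ (k i j : ℤ) :
    ⟪barlowPos 1 (Real.sqrt (2 / 3)) σ k (i + 1) j - barlowPos 1 (Real.sqrt (2 / 3)) σ k i j, ν⟫_ℝ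
      = ν 0 := by
  rw [inner_fin_three]
  simp only [PiLp.sub_apply, barlowPos_apply_zero, barlowPos_apply_one, barlowPos_apply_two]
  push_cast; ring

/-- Step of the second in-layer family: `⟪pos (k, i, j+1) − pos (k, i, j), ν⟫ = ν₀/2 + (√3/2)ν₁`. -/
theorem inner_step_basal₂ (k i j : ℤ) :
    ⟪barlowPos 1 (Real.sqrt (2 / 3)) σ k i (j + 1) - barlowPos 1 (Real.sqrt (2 / 3)) σ k i j, ν⟫_ℝ
      = ν 0 / 2 + Real.sqrt 3 / 2 * ν 1 := by
  rw [inner_fin_three]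
  simp only [PiLp.sub_apply, barlowPos_apply_zero, barlowPos_apply_one, barlowPos_apply_two]
  push_cast; ring

/-- Step of the third in-layer family:
`⟪pos (k, i+1, j−1) − pos (k, i, j), ν⟫ = ν₀/2 − (√3/2)ν₁`. -/
theorem inner_step_basal₃ (k i j : ℤ) :
    ⟪barlowPos 1 (Real.sqrt (2 / 3)) σ k (i + 1) (j - 1) - barlowPos 1 (Real.sqrt (2 / 3)) σ k i j,
      ν⟫_ℝ = ν 0 / 2 - Real.sqrt 3 / 2 * ν 1 := by
  rw [inner_fin_three]
  simp only [PiLp.sub_apply, barlowPos_apply_zero, barlowPos_apply_one, barlowPos_apply_two]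
  push_cast; ring

/-- Step of a chain family with offset `(P, Q)` from layer `k`:
`⟪pos (k+1, i−P, j−Q) − pos (k, i, j), ν⟫ = −P ν₀ − Q (ν₀/2 + (√3/2)ν₁) + σ_k (ν₀/2 + (√3/6)ν₁)
+ h ν₂`. -/
theorem inner_step_chain (k i j P Q : ℤ) :
    ⟪barlowPos 1 (Real.sqrt (2 / 3)) σ (k + 1) (i - P) (j - Q) -
        barlowPos 1 (Real.sqrt (2 / 3)) σ k i j, ν⟫_ℝ =
      -(P : ℝ) * ν 0 - (Q : ℝ) * (ν 0 / 2 + Real.sqrt 3 / 2 * ν 1) +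
        (σ k : ℝ) * (ν 0 / 2 + Real.sqrt 3 / 6 * ν 1) + Real.sqrt (2 / 3) * ν 2 := by
  rw [inner_fin_three]
  simp only [PiLp.sub_apply, barlowPos_apply_zero, barlowPos_apply_one, barlowPos_apply_two,
    haggLabel_succ]
  push_cast; ring

/-! ## Every step has length one -/

variable {σ}

/-- In-layer step `(k, i+1, j)` has length `1`. -/
theorem dist_step_basal₁ (hσ : IsHaggSeq σ) (k i j : ℤ) :
    dist (barlowPos 1 (Real.sqrt (2 / 3)) σ k (i + 1) j) (barlowPos 1 (Real.sqrt (2 / 3)) σ k i j)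
      = 1 := by
  rw [dist_comm]
  have := (site_adj_iff hσ (k, i, j) (k, i + 1, j)).2
    (Or.inl ⟨rfl, by simp [Literature.MathematicalPhysics.StatisticalMechanics.sixOffsets]⟩)
  simpa using this

/-- In-layer step `(k, i, j+1)` has length `1`. -/
theorem dist_step_basal₂ (hσ : IsHaggSeq σ) (k i j : ℤ) :
    dist (barlowPos 1 (Real.sqrt (2 / 3)) σ k i (j + 1)) (barlowPos 1 (Real.sqrt (2 / 3)) σ k i j)
      = 1 := by
  rw [dist_comm]
  have := (site_adj_iff hσ (k, i, j) (k, i, j + 1)).2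
    (Or.inl ⟨rfl, by simp [Literature.MathematicalPhysics.StatisticalMechanics.sixOffsets]⟩)
  simpa using this

/-- In-layer step `(k, i+1, j−1)` has length `1`. -/
theorem dist_step_basal₃ (hσ : IsHaggSeq σ) (k i j : ℤ) :
    dist (barlowPos 1 (Real.sqrt (2 / 3)) σ k (i + 1) (j - 1))
      (barlowPos 1 (Real.sqrt (2 / 3)) σ k i j) = 1 := by
  rw [dist_comm]
  have := (site_adj_iff hσ (k, i, j) (k, i + 1, j - 1)).2
    (Or.inl ⟨rfl, by simp [Literature.MathematicalPhysics.StatisticalMechanics.sixOffsets]⟩)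
  simpa using this

/-- A chain step with an admissible offset has length `1`. -/
theorem dist_step_chain (hσ : IsHaggSeq σ) (k i j : ℤ) {PQ : ℤ × ℤ}
    (hPQ : PQ ∈ threeOffsets (-σ k)) :
    dist (barlowPos 1 (Real.sqrt (2 / 3)) σ (k + 1) (i - PQ.1) (j - PQ.2))
      (barlowPos 1 (Real.sqrt (2 / 3)) σ k i j) = 1 := by
  rw [dist_comm]
  have := (site_adj_iff hσ (k, i, j) (k + 1, i - PQ.1, j - PQ.2)).2
    (Or.inr (Or.inl ⟨rfl, by simpa using hPQ⟩))
  simpa using this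

end Steps

end Summit.Ventures.Crystal3D.Theorems

end
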